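import Mathlib
import Summits.NavierStokesRegularity.NavierStokesRegularity.Theorems.FilamentSkeletonRssStadiumChordPerturb

/-!
# Route `FilamentSkeletonRss` · child crux `TangentSkeletonNearStraightL` (stmt-NavierStokesRegularity-23320) · registered line
# `child_tangent_analytic_strip_L` (b0b56c52900dd90a), stub `stub_stripPropagation` — brick for `rcore`: RELATIVE MARGINS SURVIVE THE FREEZE (with the core floor)

Near the target the corner certificates are RELATIVE (`c·‖z₀ − ζ‖² ≤ Re Σᵢ (Fᵢ z₀ − Fᵢ ζ)²`: `c = 1/2` for short chords by
`Theorems.StadiumDescentShortChord.descent_chord_sq_sub_sq_le`, `c = 3/20` on the long plateau by `Theorems.StadiumPlateauLeftLong`), so the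
absolute persistence lemma `Theorems.StadiumChordPerturb.re_chord_sq_core_ge_of_near` is void as `ζ → z₀`.  The `/16` build handled this with the
core floor (`Theorems.StadiumBaseMargin`); here is the `/4` form, geometry-free: with `‖F′‖ ≤ M` on the (convex) stadium, a floor `g₀ ≤ Re C`
(`C = κ·G(ζ)`, `g₀ = κΛ⁻¹/2`), and a freeze radius `δ` with `72M⁴δ² ≤ c·g₀`, `12M²δ² ≤ g₀`, every target `z` with `‖z − z₀‖ ≤ δ` keeps
  `(c/2)‖z₀ − ζ‖² + g₀/2 ≤ Re(Σᵢ (Fᵢ z − Fᵢ ζ)² + C)`   (`quad_margin_of_near`)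
— the uniform-in-`z` quadratic-plus-floor margin that makes the near-target plateau/descent majorant `((c/2)s² + g₀/2)^{-3/2}·…` integrable
(`Theorems.StadiumNearKernelBound.near_kernel_integral_le`).  Also the pure-algebra core `quad_floor_absorb`.
HONEST FRAMING: a brick for a plan about a HYPOTHETICAL filament skeleton on the NEGATIVE side of a MODEL route; the stub `stub_stripPropagation` is NOT
closed by this file; nothing here bears on Navier–Stokes regularity or blow-up.  `--supports stmt-NavierStokesRegularity-23320`.
-/

set_option linter.dupNamespace false

noncomputable section

namespace Summit.NavierStokesRegularity.NavierStokesRegularity.Theorems.StadiumFreezeMargin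

open Set Metric
open scoped BigOperators
open Summit.NavierStokesRegularity.NavierStokesRegularity.Theorems.StadiumChordPerturb

/-- **Absorbing a linear perturbation into a quadratic margin plus a floor** (pure algebra): with `0 < c`,
`72M⁴δ² ≤ c·g₀` and `12M²δ² ≤ g₀`: `c ℓ² − 3M²δ((ℓ + δ) + ℓ) + g₀ ≥ (c/2)ℓ² + g₀/2`. [folklore] -/
theorem quad_floor_absorb {c g₀ δ ℓ M : ℝ} (hc : 0 < c)
    (h1 : 72 * M ^ 4 * δ ^ 2 ≤ c * g₀) (h2 : 12 * M ^ 2 * δ ^ 2 ≤ g₀) :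
    c / 2 * ℓ ^ 2 + g₀ / 2 ≤ c * ℓ ^ 2 - 3 * M ^ 2 * δ * ((ℓ + δ) + ℓ) + g₀ := by
  -- AM–GM: `6M²δℓ ≤ (c/2)ℓ² + 18M⁴δ²/c`
  have hamgm : 6 * M ^ 2 * δ * ℓ ≤ c / 2 * ℓ ^ 2 + 18 * M ^ 4 * δ ^ 2 / c := by
    have h := sq_nonneg (c * ℓ - 6 * M ^ 2 * δ)
    have e : (c * ℓ - 6 * M ^ 2 * δ) ^ 2 / (2 * c) = c / 2 * ℓ ^ 2 - 6 * M ^ 2 * δ * ℓ + 18 * M ^ 4 * δ ^ 2 / c := by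
      field_simp
      ring
    have h' : 0 ≤ (c * ℓ - 6 * M ^ 2 * δ) ^ 2 / (2 * c) := div_nonneg h (by positivity)
    linarith
  have h3 : 18 * M ^ 4 * δ ^ 2 / c ≤ g₀ / 4 := by
    rw [div_le_iff₀ hc]; linarith
  nlinarith

/-- **Relative margins survive the freeze.**  Stadium `S = {|Im| < hs, |Re − cc| < L + hs}`, `F` holomorphic on `S` with `‖F′‖ ≤ M`;
`z₀, z, ζ ∈ S`; a relative margin `c‖z₀ − ζ‖² ≤ Re Σᵢ (Fᵢ z₀ − Fᵢ ζ)²` (`0 < c`), a floor `g₀ ≤ Re C`, and `‖z − z₀‖ ≤ δ` with `72M⁴δ² ≤ c·g₀`,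
`12M²δ² ≤ g₀`.  Then `(c/2)‖z₀ − ζ‖² + g₀/2 ≤ Re(Σᵢ (Fᵢ z − Fᵢ ζ)² + C)`. [folklore] -/
theorem quad_margin_of_near {hs L cc M : ℝ} {F : ℂ → (Fin 3 → ℂ)}
    (hF : DifferentiableOn ℂ F {z : ℂ | |z.im| < hs ∧ |z.re - cc| < L + hs})
    (hM : ∀ z ∈ {z : ℂ | |z.im| < hs ∧ |z.re - cc| < L + hs}, ‖deriv F z‖ ≤ M) (hM0 : 0 ≤ M)
    {z z₀ ζ : ℂ} (hz : z ∈ {z : ℂ | |z.im| < hs ∧ |z.re - cc| < L + hs})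
    (hz₀ : z₀ ∈ {z : ℂ | |z.im| < hs ∧ |z.re - cc| < L + hs}) (hζ : ζ ∈ {z : ℂ | |z.im| < hs ∧ |z.re - cc| < L + hs})
    {c g₀ δ : ℝ} (hc : 0 < c) (hmargin : c * ‖z₀ - ζ‖ ^ 2 ≤ (∑ i, (F z₀ i - F ζ i) ^ 2).re)
    {C : ℂ} (hfloor : g₀ ≤ C.re) (hδ : ‖z - z₀‖ ≤ δ)
    (h1 : 72 * M ^ 4 * δ ^ 2 ≤ c * g₀) (h2 : 12 * M ^ 2 * δ ^ 2 ≤ g₀) :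
    c / 2 * ‖z₀ - ζ‖ ^ 2 + g₀ / 2 ≤ ((∑ i, (F z i - F ζ i) ^ 2) + C).re := by
  have hδ0 : 0 ≤ δ := (norm_nonneg _).trans hδ
  set ℓ : ℝ := ‖z₀ - ζ‖ with hℓ
  have hℓ0 : 0 ≤ ℓ := norm_nonneg _
  -- the perturbation bound
  have hpert := chord_sq_sub_chord_sq_le hF hM hM0 hz hz₀ hζ
  have hzζ : ‖z - ζ‖ ≤ ℓ + δ := by
    have h := norm_sub_le_norm_sub_add_norm_sub z z₀ ζ
    rw [hℓ]; linarith
  have hbound : 3 * M ^ 2 * ‖z - z₀‖ * (‖z - ζ‖ + ‖z₀ - ζ‖) ≤ 3 * M ^ 2 * δ * ((ℓ + δ) + ℓ) := by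
    have hA : 0 ≤ 3 * M ^ 2 := by positivity
    have := mul_le_mul hδ (add_le_add hzζ (le_refl ℓ)) (by positivity) hδ0
    calc 3 * M ^ 2 * ‖z - z₀‖ * (‖z - ζ‖ + ‖z₀ - ζ‖) = 3 * M ^ 2 * (‖z - z₀‖ * (‖z - ζ‖ + ‖z₀ - ζ‖)) := by ring
      _ ≤ 3 * M ^ 2 * (δ * ((ℓ + δ) + ℓ)) := mul_le_mul_of_nonneg_left this hA
      _ = 3 * M ^ 2 * δ * ((ℓ + δ) + ℓ) := by ring
  have hre : ((∑ i, (F z₀ i - F ζ i) ^ 2).re) - 3 * M ^ 2 * δ * ((ℓ + δ) + ℓ) ≤ (∑ i, (F z i - F ζ i) ^ 2).re := by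
    have h := (Complex.abs_re_le_norm _).trans (hpert.trans hbound)
    rw [Complex.sub_re] at h
    have := (abs_le.1 h).1
    linarith
  have halg := quad_floor_absorb (M := M) (ℓ := ℓ) hc h1 h2
  rw [Complex.add_re]
  linarith

end Summit.NavierStokesRegularity.NavierStokesRegularity.Theorems.StadiumFreezeMargin

end
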